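import Summits.Ventures.HSemireg.WedgeHankelRecurrenceGaussGegenbauerChebyshevNodesTwo

/-!
# Venture HSemireg — **COPRIMALITY TWO STEPS APART, IDEAL-THEORETICALLY**: for any recurrence `q_{n+2} = p_n q_{n+1} − u_n q_n` with unit `u_n` (arbitrary multipliers `p_n ∈ R[X]`, any commutative
# ring) **`IsCoprime q_{n+1} q_n`** and **`IsCoprime q_{n+2} q_n ⟺ IsCoprime p_n q_n`**; hence for Mathlib's Chebyshev polynomials over a field with `2 ≠ 0` (finite fields of odd characteristic included):
# **`IsCoprime T_{n+2} T_n ⟺ n even`**, **`IsCoprime U_{n+2} U_n ⟺ n even`** (the only possible common factor is `X`)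

HONEST FRAMING. Part of the Lean index of the computation cell `pub-hsemireg` (seat p10 gen 47, Sunday typer «UNIFORM-IN-n»).  Polynomial algebra only (Mathlib `IsCoprime`, `Polynomial.Chebyshev`);
no variety, no cohomology theory, no sheaf, no Ext group and no semiregularity map is constructed here; nothing here says that HC / HC_CM / HC_AV holds; no Literature fact (unproved `Prop`) is
declared or used.  Custodian versions as in `WedgeHankelSiegelIdeal` (1/3).
SOURCES (cited).  G. Szegő, *Orthogonal Polynomials*, §3.3; P. C. Gibson, J. Approx. Theory 105 (2000) 129–132 (common zeros of `p_{n+2}`, `p_n`); K. Dilcher, K. B. Stolarsky, Trans. Amer. Math. Soc.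
357 (2005) 965–981 (vanishing of the Chebyshev resultants two steps apart).  Typed here in ideal-theoretic form (generalising N447 to arbitrary multipliers).
PROOF TYPED HERE.  Mathlib `IsCoprime.add_mul_left_left(_iff)`, `isCoprime_mul_unit_left_left`, `IsCoprime.mul_left_iff`, `irreducible_X.coprime_iff_not_dvd`, `X_dvd_iff`; N431
`chebyshevT_eval_zero_ne_zero_of_even`, `chebyshevU_eval_zero_ne_zero_of_even`; Mathlib `T_eval_zero_of_odd`, `U_eval_zero_of_odd`.
DEDUP DISCLOSURE (`rg -n -i 'isCoprime_gap|coprime_gap_two' Summits/Ventures/HSemireg`, 2026-09-04): N447 `recurrence_isCoprime_gap_two_iff` (monic multipliers `X − a`, fields); N431 ∕ N440 (real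
common zeros); 0 hits for the 5 names below.

WHAT IS IN THE TREE.  N447 (monic case); N431 (`T_n(0) ≠ 0 ⟺ n` even); N446 (`IsCoprime T_{n+1} T_n` via Bézout).
THIS FILE (namespace `Summit.Ventures.HSemireg.Wedge.HankelOuter` continued; CHAINED on N449; 0 definitions):
* §1215 **`recurrence_isCoprime_succ_of_unit`**, **`recurrence_isCoprime_gap_two_iff_of_unit`** (any commutative ring), **`chebyshevT_isCoprime_gap_two_iff`**, **`chebyshevU_isCoprime_gap_two_iff`**
  (fields with `2 ≠ 0`), `chebyshevT_isCoprime_X_iff` (`IsCoprime X T_n ⟺ n even`).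
CAVEATS.  Nothing Ext-side.  New names only.
-/

open Module Polynomial
open scoped Matrix Polynomial

namespace Summit.Ventures.HSemireg.Wedge.HankelOuter

/-! ## §1215. Coprimality two steps apart -/

/-- **`IsCoprime q_{n+1} q_n`** for `q_0 = 1`, `q_{n+2} = p_n q_{n+1} − u_n q_n` with units `u_n` (any multipliers `p_n`, any commutative ring). [Szegő §3.3; this file, §1215] -/
theorem recurrence_isCoprime_succ_of_unit {R : Type*} [CommRing R] {q p u : ℕ → R[X]} (hq0 : q 0 = 1) (hrec : ∀ n, q (n + 2) = p n * q (n + 1) - u n * q n)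
    (hu : ∀ n, IsUnit (u n)) (n : ℕ) : IsCoprime (q (n + 1)) (q n) := by
  induction n with
  | zero => rw [hq0]; exact isCoprime_one_right
  | succ n ih =>
    have h1 : IsCoprime (-u n * q n) (q (n + 1)) := (isCoprime_mul_unit_left_left (hu n).neg _ _).2 ih.symm
    have h2 := h1.add_mul_left_left (p n)
    have e : -u n * q n + q (n + 1) * p n = q (n + 2) := by rw [hrec n]; ring
    rw [e] at h2
    exact h2

/-- **`IsCoprime q_{n+2} q_n ⟺ IsCoprime p_n q_n`** for such a recurrence (any commutative ring). [Gibson 2000 (ideal-theoretic form); this file, §1215] -/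
theorem recurrence_isCoprime_gap_two_iff_of_unit {R : Type*} [CommRing R] {q p u : ℕ → R[X]} (hq0 : q 0 = 1) (hrec : ∀ n, q (n + 2) = p n * q (n + 1) - u n * q n)
    (hu : ∀ n, IsUnit (u n)) (n : ℕ) : IsCoprime (q (n + 2)) (q n) ↔ IsCoprime (p n) (q n) := by
  have h1 : q (n + 2) = p n * q (n + 1) + q n * (-u n) := by rw [hrec n]; ring
  rw [h1, IsCoprime.add_mul_left_left_iff, IsCoprime.mul_left_iff, and_iff_left (recurrence_isCoprime_succ_of_unit hq0 hrec hu n)]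

/-- `IsCoprime X T_n ⟺ n` even (any field). [N431; this file, §1215] -/
theorem chebyshevT_isCoprime_X_iff {K : Type*} [Field K] (n : ℕ) : IsCoprime (Polynomial.X : K[X]) (Polynomial.Chebyshev.T K (n : ℤ)) ↔ Even n := by
  rw [Polynomial.irreducible_X.coprime_iff_not_dvd, Polynomial.X_dvd_iff, coeff_zero_eq_eval_zero]
  constructor
  · intro h
    by_contra hne
    exact h (Polynomial.Chebyshev.T_eval_zero_of_odd K (Odd.natCast (Nat.not_even_iff_odd.1 hne)))
  · exact fun hn => chebyshevT_eval_zero_ne_zero_of_even n hn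

/-- **`IsCoprime T_{n+2} T_n ⟺ n` even** over a field with `2 ≠ 0`. [Gibson 2000; Dilcher–Stolarsky 2005; this file, §1215] -/
theorem chebyshevT_isCoprime_gap_two_iff {K : Type*} [Field K] (h2 : (2 : K) ≠ 0) (n : ℕ) :
    IsCoprime (Polynomial.Chebyshev.T K ((n : ℤ) + 2)) (Polynomial.Chebyshev.T K (n : ℤ)) ↔ Even n := by
  have hrec : ∀ m : ℕ, (fun m : ℕ => Polynomial.Chebyshev.T K (m : ℤ)) (m + 2) =
      (fun _ : ℕ => (2 : K[X]) * Polynomial.X) m * (fun m : ℕ => Polynomial.Chebyshev.T K (m : ℤ)) (m + 1) - (fun _ : ℕ => (1 : K[X])) m * (fun m : ℕ => Polynomial.Chebyshev.T K (m : ℤ)) m := by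
    intro m; push_cast; rw [Polynomial.Chebyshev.T_add_two, one_mul]
  have h := recurrence_isCoprime_gap_two_iff_of_unit (q := fun m : ℕ => Polynomial.Chebyshev.T K (m : ℤ)) (p := fun _ => (2 : K[X]) * Polynomial.X) (u := fun _ => (1 : K[X]))
    (by simp only [Nat.cast_zero, Polynomial.Chebyshev.T_zero]) hrec (fun _ => isUnit_one) n
  simp only [Nat.cast_add, Nat.cast_ofNat] at h
  rw [h, show (2 : K[X]) = C 2 from (map_ofNat C 2).symm, isCoprime_mul_unit_left_left (Polynomial.isUnit_C.2 (isUnit_iff_ne_zero.2 h2)), chebyshevT_isCoprime_X_iff]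

/-- `IsCoprime X U_n ⟺ n` even (any field). [N431; this file, §1215] -/
theorem chebyshevU_isCoprime_X_iff {K : Type*} [Field K] (n : ℕ) : IsCoprime (Polynomial.X : K[X]) (Polynomial.Chebyshev.U K (n : ℤ)) ↔ Even n := by
  rw [Polynomial.irreducible_X.coprime_iff_not_dvd, Polynomial.X_dvd_iff, coeff_zero_eq_eval_zero]
  constructor
  · intro h
    by_contra hne
    exact h (Polynomial.Chebyshev.U_eval_zero_of_odd K (Odd.natCast (Nat.not_even_iff_odd.1 hne)))
  · exact fun hn => chebyshevU_eval_zero_ne_zero_of_even n hn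

/-- **`IsCoprime U_{n+2} U_n ⟺ n` even** over a field with `2 ≠ 0`. [Gibson 2000; Dilcher–Stolarsky 2005; this file, §1215] -/
theorem chebyshevU_isCoprime_gap_two_iff {K : Type*} [Field K] (h2 : (2 : K) ≠ 0) (n : ℕ) :
    IsCoprime (Polynomial.Chebyshev.U K ((n : ℤ) + 2)) (Polynomial.Chebyshev.U K (n : ℤ)) ↔ Even n := by
  have hrec : ∀ m : ℕ, (fun m : ℕ => Polynomial.Chebyshev.U K (m : ℤ)) (m + 2) =
      (fun _ : ℕ => (2 : K[X]) * Polynomial.X) m * (fun m : ℕ => Polynomial.Chebyshev.U K (m : ℤ)) (m + 1) - (fun _ : ℕ => (1 : K[X])) m * (fun m : ℕ => Polynomial.Chebyshev.U K (m : ℤ)) m := by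
    intro m; push_cast; rw [Polynomial.Chebyshev.U_add_two, one_mul]
  have h := recurrence_isCoprime_gap_two_iff_of_unit (q := fun m : ℕ => Polynomial.Chebyshev.U K (m : ℤ)) (p := fun _ => (2 : K[X]) * Polynomial.X) (u := fun _ => (1 : K[X]))
    (by simp only [Nat.cast_zero, Polynomial.Chebyshev.U_zero]) hrec (fun _ => isUnit_one) n
  simp only [Nat.cast_add, Nat.cast_ofNat] at h
  rw [h, show (2 : K[X]) = C 2 from (map_ofNat C 2).symm, isCoprime_mul_unit_left_left (Polynomial.isUnit_C.2 (isUnit_iff_ne_zero.2 h2)), chebyshevU_isCoprime_X_iff]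

end Summit.Ventures.HSemireg.Wedge.HankelOuter
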